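import Summits.NavierStokesRegularity.NavierStokesRegularity.Theses.TypeICertificateLadder
import Literature.Analysis.FluidPDE.KNSSAxisymmetricNoSwirl
import Literature.Analysis.FluidPDE.AncientMildWeak
import Literature.Analysis.FluidPDE.ClassicalSolutionCalculus
import Literature.Analysis.FluidPDE.TaoEnstrophyLocalisationProofs
import Literature.Analysis.FluidPDE.HeatDuhamelBack

/-!
# Crux `Target` = `TypeICertificateLadder.NoTypeIBlowup` (stmt-NavierStokesRegularity-1217), negative side:
# the finite-energy (Leray–Hopf) clause is load-bearing

Negative-side (cdisprove, D-0016) support lemmas extracted from the crux work file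
`Cruxes/Target/Disproof.lean` (§§1–2b) so that ideators / planners / provers can IMPORT them. The crux
(shared verbatim as `ThreadingFlux.Target`, `CoreLogGas.NoTypeIBlowup`): a classical solution of
unforced NS on `ℝ³ × [0, T)`, Leray–Hopf on `[0, T]` from the rapidly decaying datum `u 0`, with
the Type-I rate `‖u(t, x)‖ ≤ C / √(T - t)` as `t ↑ T`, extends classically past `T`.

* `isClassicalNSSolutionOn_uniform` — the parasitic family of Koch–Nadirashvili–Seregin–Šverák
  (Acta Math. 203 (2009), §1 p. 3; Serrin's `a(t)∇h`, `h = ⟪e, x⟫`): every spatially uniform flow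
  `u = a(t) e`, `p = -a'(t) ⟪e, x⟫` is a classical solution, for every viscosity.
* `target_false_without_lerayHopf` — with `IsLerayHopfOn T ν 0 (u 0) u` DELETED the crux is FALSE:
  the drift flow `a(t) = -log(1 - t)`, `T = 1` (from rest, Type-I constant `2`, `‖u(t, 0)‖ → ∞`).
* `target_false_without_energy` — the drift flow is even a pressure-free WEAK solution
  (`isWeakNSSolutionOn_uniform`: compactly supported solenoidal tests have zero mean), so weakening
  `IsLerayHopfOn` to its first field `IsWeakNSSolutionOn` still gives a FALSE statement: exactly
  the finite-energy clauses are load-bearing (any proof must use `u(t) ∈ L²` / the energy inequality).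
Nothing here closes the item (`--supports`). [cite: KochNadirashviliSereginSverak2009, §1 p. 3 (parasitic solutions)]
-/

noncomputable section

open MeasureTheory TopologicalSpace Set Function Filter Metric
open scoped Topology RealInnerProductSpace ContDiff Laplacian InnerProductSpace
open Literature.Analysis.FluidPDE

namespace Summit.NavierStokesRegularity.NavierStokesRegularity.Theorems.Target.Negative

/-- Local notation for physical space `ℝ³ = EuclideanSpace ℝ (Fin 3)`. -/
local notation "ℝ³" => EuclideanSpace ℝ (Fin 3)

/-- The crux under attack, by name (item stmt-NavierStokesRegularity-1217). -/
abbrev Target : Prop :=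
  Summit.NavierStokesRegularity.NavierStokesRegularity.Theses.TypeICertificateLadder.NoTypeIBlowup

/-! ## §1 The parasitic family: spatially uniform pressure-driven flows -/

section Uniform

variable {E : Type*} [NormedAddCommGroup E] [InnerProductSpace ℝ E]

/-- Spatially uniform velocity `u(t, x) = a(t) e`. -/
def uniformVel (a : ℝ → ℝ) (e : E) : ℝ → E → E := fun t _ => a t • e

/-- The linear pressure `p(t, x) = ⟪-b(t) e, x⟫ = -b(t) ⟪e, x⟫` driving the uniform flow
(`b = a'`). -/
def uniformPres (b : ℝ → ℝ) (e : E) : ℝ → E → ℝ := fun t x => ⟪(-b t) • e, x⟫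

/-- Pointwise value of the uniform velocity. -/
@[simp] theorem uniformVel_apply (a : ℝ → ℝ) (e : E) (t : ℝ) (x : E) :
    uniformVel a e t x = a t • e := rfl

/-- Pointwise value of the linear pressure. -/
@[simp] theorem uniformPres_apply (b : ℝ → ℝ) (e : E) (t : ℝ) (x : E) :
    uniformPres b e t x = ⟪(-b t) • e, x⟫ := rfl

variable [FiniteDimensional ℝ E]

/-- The gradient of `y ↦ ⟪v, y⟫` is `v`. -/
theorem hasGradientAt_inner_left (v x : E) : HasGradientAt (fun y : E => ⟪v, y⟫) v x := by
  rw [hasGradientAt_iff_hasFDerivAt]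
  have h := (InnerProductSpace.toDual ℝ E v).hasFDerivAt (x := x)
  have hfun : (fun y : E => ⟪v, y⟫) = ⇑(InnerProductSpace.toDual ℝ E v) := by
    funext y
    exact (InnerProductSpace.toDual_apply_apply).symm
  rw [hfun]
  exact h

/-- `∇p(t, ·) = -b(t) e`. -/
theorem gradient_uniformPres (b : ℝ → ℝ) (e : E) (t : ℝ) (x : E) :
    gradient (uniformPres b e t) x = (-b t) • e :=
  (hasGradientAt_inner_left ((-b t) • e) x).gradient

omit [FiniteDimensional ℝ E] in
/-- Constant fields are divergence free. -/
theorem isDivFree_const (c : E) : VectorCalculus.IsDivFree (fun _ : E => c) := fun x => by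
  show LinearMap.trace ℝ E (fderiv ℝ (fun _ : E => c) x : E →ₗ[ℝ] E) = 0
  simp

variable {S : Set ℝ} {a : ℝ → ℝ}

/-- **Every spatially uniform flow is a classical Navier–Stokes solution** on any time set of
unique differentiability, for every viscosity, with the linear pressure `p = ⟪-(a') e, x⟫` (`a'` the
derivative within `S`): `∂ₜu = a' e = -∇p`, `(u·∇)u = 0`, `Δu = 0`, `div u = 0` (KNSS 2009 §1 p. 3). -/
theorem isClassicalNSSolutionOn_uniform (hS : UniqueDiffOn ℝ S) (ha : ContDiffOn ℝ ∞ a S)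
    (ν : ℝ) (e : E) :
    IsClassicalNSSolutionOn S ν 0 (uniformVel a e) (uniformPres (derivWithin a S) e) where
  smooth_velocity := by
    have h1 : ContDiffOn ℝ ∞ (fun z : ℝ × E => a z.1) (S ×ˢ univ) :=
      ha.comp contDiffOn_fst fun z hz => (mem_prod.1 hz).1
    show ContDiffOn ℝ ∞ (fun z : ℝ × E => a z.1 • e) (S ×ˢ univ)
    exact h1.smul contDiffOn_const
  smooth_pressure := by
    have hb : ContDiffOn ℝ ∞ (derivWithin a S) S := ((contDiffOn_infty_iff_derivWithin hS).1 ha).2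
    have h1 : ContDiffOn ℝ ∞ (fun z : ℝ × E => (-(derivWithin a S z.1)) • e) (S ×ˢ univ) :=
      ((hb.comp contDiffOn_fst fun z hz => (mem_prod.1 hz).1).neg).smul contDiffOn_const
    show ContDiffOn ℝ ∞ (fun z : ℝ × E => ⟪(-(derivWithin a S z.1)) • e, z.2⟫) (S ×ˢ univ)
    exact h1.inner ℝ contDiffOn_snd
  momentum t ht x := by
    have hdiff : DifferentiableWithinAt ℝ a S t := (ha.differentiableOn (by simp)) t ht
    have h1 : timeDerivWithin S (uniformVel a e) t x = derivWithin a S t • e := by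
      rw [timeDerivWithin_apply]
      show derivWithin (fun s => a s • e) S t = derivWithin a S t • e
      exact derivWithin_smul_const hdiff e
    have h2 : convect (uniformVel a e t) (uniformVel a e t) x = 0 := by
      show fderiv ℝ (fun _ : E => a t • e) x (a t • e) = 0
      simp
    have h3 : Δ (uniformVel a e t) x = 0 := by
      show Δ (fun _ : E => a t • e) x = 0
      rw [InnerProductSpace.laplacian_const]; rfl
    rw [h1, h2, h3, gradient_uniformPres]
    simp
  divFree t _ := isDivFree_const (a t • e)

end Uniform

/-! ## §2 The drift flow `u = -log(1 - t) e₀`: the Leray–Hopf clause is load-bearing -/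

/-- The unit vector `e₀`. -/
def e₀ : ℝ³ := EuclideanSpace.single 0 1

/-- `‖e₀‖ = 1`. -/
@[simp] theorem norm_e₀ : ‖e₀‖ = 1 := by simp [e₀]

/-- `-log y ≤ y^{-ε} / ε` for `0 < y` (from Mathlib's `log x ≤ x^ε / ε` at `x = y⁻¹`). -/
theorem neg_log_le_rpow_div {y ε : ℝ} (hy : 0 < y) (hε : 0 < ε) :
    -Real.log y ≤ y ^ (-ε) / ε := by
  have h := Real.log_le_rpow_div (inv_nonneg.2 hy.le) hε
  rwa [Real.log_inv, Real.inv_rpow hy.le, ← Real.rpow_neg hy.le] at h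

/-- `-log y ≤ 2 / √y` for `0 < y`. -/
theorem neg_log_le_two_div_sqrt {y : ℝ} (hy : 0 < y) : -Real.log y ≤ 2 / Real.sqrt y := by
  have h := neg_log_le_rpow_div hy (by norm_num : (0 : ℝ) < 1 / 2)
  rw [Real.rpow_neg hy.le, ← Real.sqrt_eq_rpow] at h
  calc -Real.log y ≤ (Real.sqrt y)⁻¹ / (1 / 2) := h
    _ = 2 / Real.sqrt y := by ring

/-- `√y · (-log y) ≤ 2` for `0 < y`: the drift amplitude obeys the Type-I rate with constant `2`. -/
theorem sqrt_mul_neg_log_le_two {y : ℝ} (hy : 0 < y) : Real.sqrt y * (-Real.log y) ≤ 2 := by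
  have h := neg_log_le_two_div_sqrt hy
  have hs : 0 < Real.sqrt y := Real.sqrt_pos.2 hy
  calc Real.sqrt y * (-Real.log y) ≤ Real.sqrt y * (2 / Real.sqrt y) :=
        mul_le_mul_of_nonneg_left h hs.le
    _ = 2 := by field_simp

/-- The drift amplitude `a(t) = -log(1 - t)`: `a(0) = 0`, smooth on `t < 1`, `a(t) ↑ ∞` as `t ↑ 1`. -/
def driftAmp (t : ℝ) : ℝ := -Real.log (1 - t)

/-- The drift flow `u(t, x) = -log(1 - t) e₀`. -/
def driftVel : ℝ → ℝ³ → ℝ³ := uniformVel driftAmp e₀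

/-- Its pressure `p(t, x) = ⟪-a'(t) e₀, x⟫` (`a'` within `[0, 1)`; `= -(1 - t)⁻¹ x₀` there). -/
def driftPres : ℝ → ℝ³ → ℝ := uniformPres (derivWithin driftAmp (Ico 0 1)) e₀

/-- The drift amplitude is smooth below `t = 1`. -/
theorem contDiffOn_driftAmp {S : Set ℝ} (hS : S ⊆ Iio 1) : ContDiffOn ℝ ∞ driftAmp S := by
  have h1 : ContDiffOn ℝ ∞ (fun t : ℝ => 1 - t) S := (contDiff_const.sub contDiff_id).contDiffOn
  have h2 : MapsTo (fun t : ℝ => 1 - t) S ({0}ᶜ) := fun t ht => by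
    simp only [mem_compl_iff, mem_singleton_iff]
    exact (sub_pos.2 (show t < 1 from hS ht)).ne'
  exact (Real.contDiffOn_log.comp h1 h2).neg

/-- The drift flow is a classical solution on `[0, 1)`, for every viscosity. -/
theorem isClassical_drift (ν : ℝ) : IsClassicalNSSolutionOn (Ico 0 1) ν 0 driftVel driftPres :=
  isClassicalNSSolutionOn_uniform (uniqueDiffOn_Ico 0 1) (contDiffOn_driftAmp Ico_subset_Iio_self) ν e₀

/-- The drift amplitude vanishes at `t = 0`. -/
theorem driftAmp_zero : driftAmp 0 = 0 := by simp [driftAmp]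

/-- The drift flow starts from rest. -/
theorem driftVel_zero : driftVel 0 = 0 := by
  funext x
  simp [driftVel, driftAmp_zero]

/-- The zero datum decays rapidly. -/
theorem hasRapidSpatialDecay_zero : HasRapidSpatialDecay (0 : ℝ³ → ℝ³) := fun n K =>
  ⟨0, fun x => by
    have : iteratedFDeriv ℝ n (0 : ℝ³ → ℝ³) x = 0 := by
      rw [Pi.zero_def, iteratedFDeriv_fun_zero]; rfl
    rw [this, norm_zero, mul_zero]⟩

/-- The drift flow obeys the Type-I rate at `T = 1` with constant `2`. -/
theorem isTypeIBlowup_drift : IsTypeIBlowup driftVel 1 := by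
  refine ⟨2, ?_⟩
  filter_upwards [Ioo_mem_nhdsLT (show (0 : ℝ) < 1 by norm_num)] with t ht x
  have hy : 0 < 1 - t := sub_pos.2 ht.2
  have hle : 1 - t ≤ 1 := by linarith [ht.1]
  have hlog : Real.log (1 - t) ≤ 0 := Real.log_nonpos hy.le hle
  have hn : ‖driftVel t x‖ = -Real.log (1 - t) := by
    simp [driftVel, driftAmp, norm_smul, abs_of_nonpos hlog]
  rw [hn]
  exact neg_log_le_two_div_sqrt hy

/-- The amplitude blows up as `t ↑ 1`. -/
theorem tendsto_driftAmp_atTop : Tendsto driftAmp (𝓝[<] 1) atTop := by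
  have h1 : Tendsto (fun t : ℝ => 1 - t) (𝓝[<] 1) (𝓝[>] 0) := by
    refine tendsto_nhdsWithin_iff.2 ⟨?_, ?_⟩
    · have h : Tendsto (fun t : ℝ => 1 - t) (𝓝 1) (𝓝 (1 - 1)) := tendsto_const_nhds.sub tendsto_id
      rw [sub_self] at h
      exact h.mono_left nhdsWithin_le_nhds
    · filter_upwards [self_mem_nhdsWithin] with t ht
      exact mem_Ioi.2 (sub_pos.2 (mem_Iio.1 ht))
  exact tendsto_neg_atBot_atTop.comp (Real.tendsto_log_nhdsGT_zero.comp h1)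

/-- **The drift flow has no classical extension past `T = 1`**: an extension would be continuous
at `(1, 0)` from inside `[0, T') × ℝ³`, but `‖u(t, 0)‖ = -log(1 - t) → ∞` as `t ↑ 1`. -/
theorem not_hasSmoothExtensionPast_drift (ν : ℝ) : ¬ HasSmoothExtensionPast ν 0 driftVel 1 := by
  rintro ⟨T', hT', u', p', hcl, hagree⟩
  have hmem : ((1 : ℝ), (0 : ℝ³)) ∈ Ico 0 T' ×ˢ (univ : Set ℝ³) :=
    mk_mem_prod ⟨zero_le_one, hT'⟩ (mem_univ _)
  have hcont : ContinuousWithinAt (uncurry u') (Ico 0 T' ×ˢ univ) (1, 0) :=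
    hcl.smooth_velocity.continuousOn _ hmem
  have hγ : Tendsto (fun t : ℝ => ((t, (0 : ℝ³)) : ℝ × ℝ³)) (𝓝[<] 1)
      (𝓝[Ico 0 T' ×ˢ univ] ((1 : ℝ), (0 : ℝ³))) := by
    refine tendsto_nhdsWithin_iff.2 ⟨?_, ?_⟩
    · exact ((continuous_id.prodMk continuous_const).tendsto 1).mono_left nhdsWithin_le_nhds
    · filter_upwards [Ioo_mem_nhdsLT (show (0 : ℝ) < 1 by norm_num)] with t ht
      exact mk_mem_prod ⟨ht.1.le, ht.2.trans hT'⟩ (mem_univ _)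
  have hlim : Tendsto (fun t => u' t 0) (𝓝[<] 1) (𝓝 (u' 1 0)) := hcont.tendsto.comp hγ
  have heq : (fun t => driftAmp t • e₀) =ᶠ[𝓝[<] 1] fun t => u' t 0 := by
    filter_upwards [Ioo_mem_nhdsLT (show (0 : ℝ) < 1 by norm_num)] with t ht
    rw [hagree t ⟨ht.1.le, ht.2⟩]
    rfl
  have hnorm : Tendsto (fun t => ‖driftAmp t • e₀‖) (𝓝[<] 1) (𝓝 ‖u' 1 0‖) :=
    (hlim.congr' heq.symm).norm
  have hnorm' : Tendsto (fun t => ‖driftAmp t • e₀‖) (𝓝[<] 1) atTop := by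
    have h : Tendsto (fun t => |driftAmp t|) (𝓝[<] 1) atTop :=
      tendsto_abs_atTop_atTop.comp tendsto_driftAmp_atTop
    simpa [norm_smul] using h
  exact not_tendsto_atTop_of_tendsto_nhds hnorm hnorm'

/-- The crux with the Leray–Hopf clause `IsLerayHopfOn T ν 0 (u 0) u` DELETED. -/
def TargetWithoutLerayHopf : Prop :=
  ∀ (ν T : ℝ), 0 < ν → 0 < T → ∀ (u : ℝ → ℝ³ → ℝ³) (p : ℝ → ℝ³ → ℝ),
    IsClassicalNSSolutionOn (Set.Ico 0 T) ν 0 u p → HasRapidSpatialDecay (u 0) →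
    IsTypeIBlowup u T → HasSmoothExtensionPast ν 0 u T

/-- **Any proof of the crux must use the Leray–Hopf clause**: without it the statement is false,
witnessed by the drift flow (`ν = 1`, `T = 1`). Classification if it were the crux:
refuted-misstated (missing finite-energy normalisation); the crux itself carries the clause. -/
theorem target_false_without_lerayHopf : ¬ TargetWithoutLerayHopf := fun h =>
  not_hasSmoothExtensionPast_drift 1
    (h 1 1 one_pos one_pos driftVel driftPres (isClassical_drift 1)
      (by rw [driftVel_zero]; exact hasRapidSpatialDecay_zero) isTypeIBlowup_drift)

/-- Sanity: the crux implies that the drift flow is NOT Leray–Hopf from rest. -/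
theorem not_isLerayHopfOn_drift_of_target (h : Target) {ν : ℝ} (hν : 0 < ν) :
    ¬ IsLerayHopfOn 1 ν 0 (driftVel 0) driftVel := fun hLH =>
  not_hasSmoothExtensionPast_drift ν
    (h ν 1 hν one_pos driftVel driftPres (isClassical_drift ν) hLH
      (by rw [driftVel_zero]; exact hasRapidSpatialDecay_zero) isTypeIBlowup_drift)

/-! ### §2b Of the Leray–Hopf bundle only finite energy is load-bearing (KNSS 2009 §1 p. 3:
compactly supported solenoidal fields have zero mean, so uniform flows are weak solutions). -/

/-- A compactly supported continuous field pairs integrably with a constant. -/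
theorem integrable_inner_const {g : ℝ³ → ℝ³} (hg : Continuous g) (hgc : HasCompactSupport g)
    (c : ℝ³) : Integrable (fun x => ⟪c, g x⟫) volume :=
  (continuous_const.inner hg).integrable_of_hasCompactSupport
    (hgc.comp_left (g := fun v : ℝ³ => ⟪c, v⟫) (inner_zero_right c))

/-- **Uniform flows with a locally square-integrable measurable amplitude are weak solutions**
(pressure-free, with datum `a(0) e`) on `[0, T)`, for every viscosity. -/
theorem isWeakNSSolutionOn_uniform {T ν : ℝ} {a : ℝ → ℝ} (ham : Measurable a)
    (ha2 : ∫⁻ t in Ioo 0 T, ‖a t‖ₑ ^ 2 < ⊤) (e : ℝ³) (he : ‖e‖ = 1) :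
    IsWeakNSSolutionOn T ν 0 (uniformVel a e 0) (uniformVel a e) := by
  refine ⟨?_, ?_, ?_, ?_⟩
  · -- measurability
    exact ((ham.comp measurable_fst).smul_const e).aestronglyMeasurable
  · -- local square integrability up to the time boundary
    intro K hK
    have hGm : Measurable fun t => ‖a t‖ₑ ^ 2 := ham.enorm.pow_const 2
    have h1 : ∫⁻ z in Ioo 0 T ×ˢ K, ‖uncurry (uniformVel a e) z‖ₑ ^ 2 =
        ∫⁻ z in Ioo 0 T ×ˢ K, ‖a z.1‖ₑ ^ 2 := by
      refine lintegral_congr fun z => ?_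
      show ‖a z.1 • e‖ₑ ^ 2 = ‖a z.1‖ₑ ^ 2
      rw [enorm_smul, ← ofReal_norm e, he, ENNReal.ofReal_one, mul_one]
    have h2 : ∫⁻ z in Ioo 0 T ×ˢ K, ‖a z.1‖ₑ ^ 2 = (∫⁻ t in Ioo 0 T, ‖a t‖ₑ ^ 2) * volume K := by
      rw [Measure.volume_eq_prod, ← Measure.prod_restrict,
        lintegral_prod (fun z : ℝ × ℝ³ => ‖a z.1‖ₑ ^ 2) (hGm.comp measurable_fst).aemeasurable]
      simp only [lintegral_const, Measure.restrict_apply_univ]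
      rw [lintegral_mul_const _ hGm]
    rw [h1, h2]
    exact ENNReal.mul_lt_top ha2 hK.measure_lt_top
  · -- weakly divergence free slices
    exact ae_of_all _ fun t =>
      VectorCalculus.IsDivFree.isWeaklyDivFree_holds (isDivFree_const (a t • e)) contDiff_const
  · -- the weak identity: every spatial pairing vanishes
    intro ψ hψ hdiv
    have hψ' : IsSpaceTimeTestOn (⊤ : Opens (ℝ × ℝ³)) ψ := hψ.mono le_top
    have hslice : ∀ t, ∫ x, (⟪uniformVel a e t x, timeDeriv ψ t x⟫ +
        ⟪uniformVel a e t x, convect (uniformVel a e t) (ψ t) x⟫ +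
        ν * ⟪uniformVel a e t x, Δ (ψ t) x⟫ + ⟪(0 : ℝ → ℝ³ → ℝ³) t x, ψ t x⟫) = 0 := by
      intro t
      set c : ℝ³ := a t • e with hc
      -- the three compactly supported divergence-free `C¹` fields
      have hψ3 : ContDiff ℝ 3 (ψ t) := contDiff_infty.1 (hψ'.contDiff_slice t) 3
      have hψ2 : ContDiff ℝ 2 (ψ t) := contDiff_infty.1 (hψ'.contDiff_slice t) 2
      have g1d : ContDiff ℝ 1 (timeDeriv ψ t) := contDiff_infty.1 (hψ'.timeDeriv_top.contDiff_slice t) 1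
      have g1c : HasCompactSupport (timeDeriv ψ t) := hψ'.timeDeriv_top.hasCompactSupport_slice t
      have g1v : VectorCalculus.IsDivFree (timeDeriv ψ t) := hψ'.isDivFree_timeDeriv hdiv t
      have g2d : ContDiff ℝ 1 (fun x => fderiv ℝ (ψ t) x c) :=
        (hψ2.fderiv_right (m := 1) (by norm_num)).clm_apply contDiff_const
      have g2c : HasCompactSupport (fun x => fderiv ℝ (ψ t) x c) :=
        (hψ'.hasCompactSupport_slice t).fderiv_apply (𝕜 := ℝ) c
      have g2v : VectorCalculus.IsDivFree (fun x => fderiv ℝ (ψ t) x c) :=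
        VectorCalculus.IsDivFree.fderiv_apply hψ2 (hdiv t) c
      have g3d : ContDiff ℝ 1 (Δ (ψ t)) := contDiff_infty.1 (hψ'.laplacian_top.contDiff_slice t) 1
      have g3c : HasCompactSupport (Δ (ψ t)) := hψ'.laplacian_top.hasCompactSupport_slice t
      have g3v : VectorCalculus.IsDivFree (Δ (ψ t)) := isDivFree_laplacian_of_contDiff hψ3 (hdiv t)
      have i1 := integral_inner_const_eq_zero_of_isDivFree c g1d g1c g1v
      have i2 := integral_inner_const_eq_zero_of_isDivFree c g2d g2c g2v
      have i3 := integral_inner_const_eq_zero_of_isDivFree c g3d g3c g3v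
      have I1 := integrable_inner_const g1d.continuous g1c c
      have I2 := integrable_inner_const g2d.continuous g2c c
      have I3 := (integrable_inner_const g3d.continuous g3c c).const_mul ν
      have hfun : (fun x => ⟪uniformVel a e t x, timeDeriv ψ t x⟫ +
          ⟪uniformVel a e t x, convect (uniformVel a e t) (ψ t) x⟫ +
          ν * ⟪uniformVel a e t x, Δ (ψ t) x⟫ + ⟪(0 : ℝ → ℝ³ → ℝ³) t x, ψ t x⟫) =
          fun x => ⟪c, timeDeriv ψ t x⟫ + ⟪c, fderiv ℝ (ψ t) x c⟫ + ν * ⟪c, Δ (ψ t) x⟫ := by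
        funext x
        simp [hc, convect]
      have I12 : Integrable (fun x => ⟪c, timeDeriv ψ t x⟫ + ⟪c, fderiv ℝ (ψ t) x c⟫) volume :=
        I1.add I2
      rw [hfun, integral_add I12 I3, integral_add I1 I2, integral_const_mul, i1, i2, i3]
      ring
    have hdatum : ∫ x, ⟪uniformVel a e 0 x, ψ 0 x⟫ = 0 :=
      integral_inner_const_eq_zero_of_isDivFree (a 0 • e)
        (contDiff_infty.1 (hψ'.contDiff_slice 0) 1) (hψ'.hasCompactSupport_slice 0) (hdiv 0)
    simp_rw [hslice]
    rw [hdatum, integral_zero, add_zero]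

/-- The drift amplitude is measurable. -/
theorem measurable_driftAmp : Measurable driftAmp :=
  (Real.measurable_log.comp (measurable_const.sub measurable_id)).neg

/-- `(-log y)² ≤ 16 y^{-1/2}` on `0 < y ≤ 1`. -/
theorem neg_log_sq_le {y : ℝ} (hy : 0 < y) (hy1 : y ≤ 1) :
    (-Real.log y) ^ 2 ≤ 16 * y ^ (-(1 / 2 : ℝ)) := by
  have h := neg_log_le_rpow_div hy (by norm_num : (0 : ℝ) < 1 / 4)
  have h0 : 0 ≤ -Real.log y := by
    have := Real.log_nonpos hy.le hy1
    linarith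
  have h4 : -Real.log y ≤ 4 * y ^ (-(1 / 4 : ℝ)) := by
    calc -Real.log y ≤ y ^ (-(1 / 4 : ℝ)) / (1 / 4) := h
      _ = 4 * y ^ (-(1 / 4 : ℝ)) := by ring
  have hpow : (y ^ (-(1 / 4 : ℝ))) ^ 2 = y ^ (-(1 / 2 : ℝ)) := by
    rw [← Real.rpow_natCast, ← Real.rpow_mul hy.le]
    norm_num
  calc (-Real.log y) ^ 2 ≤ (4 * y ^ (-(1 / 4 : ℝ))) ^ 2 := by gcongr
    _ = 16 * y ^ (-(1 / 2 : ℝ)) := by rw [mul_pow, hpow]; norm_num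

/-- The drift amplitude is square integrable in time on `(0, 1)`. -/
theorem lintegral_driftAmp_sq_lt_top : ∫⁻ t in Ioo (0 : ℝ) 1, ‖driftAmp t‖ₑ ^ 2 < ⊤ := by
  have hint : IntervalIntegrable (fun x : ℝ => x ^ (-(1 / 2 : ℝ))) volume 0 1 :=
    intervalIntegral.intervalIntegrable_rpow' (by norm_num)
  have hint2 : IntervalIntegrable (fun x : ℝ => (1 - x) ^ (-(1 / 2 : ℝ))) volume (1 - 0) (1 - 1) :=
    hint.comp_sub_left 1
  rw [sub_zero, sub_self] at hint2
  have hint3 : IntegrableOn (fun x : ℝ => 16 * (1 - x) ^ (-(1 / 2 : ℝ))) (Ioo 0 1) :=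
    ((intervalIntegrable_iff_integrableOn_Ioo_of_le (by norm_num)).1 hint2.symm).const_mul 16
  refine lt_of_le_of_lt (setLIntegral_mono' measurableSet_Ioo fun t ht => ?_) hint3.setLIntegral_lt_top
  have hy : 0 < 1 - t := sub_pos.2 ht.2
  have hy1 : 1 - t ≤ 1 := by linarith [ht.1]
  rw [← ofReal_norm, ← ENNReal.ofReal_pow (norm_nonneg _), Real.norm_eq_abs, driftAmp,
    abs_of_nonneg (by have := Real.log_nonpos hy.le hy1; linarith)]
  exact ENNReal.ofReal_le_ofReal (neg_log_sq_le hy hy1)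

/-- The drift flow is a weak solution on `[0, 1)` from rest, for every viscosity. -/
theorem isWeakNSSolutionOn_drift (ν : ℝ) : IsWeakNSSolutionOn 1 ν 0 (driftVel 0) driftVel :=
  isWeakNSSolutionOn_uniform measurable_driftAmp lintegral_driftAmp_sq_lt_top e₀ norm_e₀

/-- The crux with `IsLerayHopfOn T ν 0 (u 0) u` WEAKENED to its first field, the pressure-free
weak formulation `IsWeakNSSolutionOn T ν 0 (u 0) u` (all finite-energy clauses deleted). -/
def TargetWithoutEnergy : Prop :=
  ∀ (ν T : ℝ), 0 < ν → 0 < T → ∀ (u : ℝ → ℝ³ → ℝ³) (p : ℝ → ℝ³ → ℝ),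
    IsClassicalNSSolutionOn (Set.Ico 0 T) ν 0 u p → IsWeakNSSolutionOn T ν 0 (u 0) u →
    HasRapidSpatialDecay (u 0) → IsTypeIBlowup u T → HasSmoothExtensionPast ν 0 u T

/-- **Of the Leray–Hopf bundle, only the finite-energy clauses are load-bearing**: keeping the weak
formulation but deleting the energy class, the statement is false (drift flow again). -/
theorem target_false_without_energy : ¬ TargetWithoutEnergy := fun h =>
  not_hasSmoothExtensionPast_drift 1
    (h 1 1 one_pos one_pos driftVel driftPres (isClassical_drift 1) (isWeakNSSolutionOn_drift 1)
      (by rw [driftVel_zero]; exact hasRapidSpatialDecay_zero) isTypeIBlowup_drift)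

end Summit.NavierStokesRegularity.NavierStokesRegularity.Theorems.Target.Negative

end
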